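import Mathlib

/-!
# Route `DiophantineDichotomy`, crux `KhovanskiiApproxTypeEv`, line `anchored-reduction` (`Sketch`):
# stub `stub_pairSumResultant` — the resultant annihilating a sum of two algebraic numbers

Crux `Summit.Schanuel.Schanuel.Theses.DiophantineDichotomy.KhovanskiiApproxTypeEv`
(item stmt-Schanuel-14972), line `Sketch` (lead `prover-line-stmt-Schanuel-14972-c11-0`), registered
stub `stub_pairSumResultant` (`--supports`), part of the kernel hardness certificate of the naive
Lindemann–Weierstrass layer: the sum `α + β` of two algebraic numbers with integer annihilators
`P`, `Q` is annihilated by the classical resultant `R(X) = Res_Y (P(Y), Q(X - Y)) ∈ ℤ[X]`.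

This file is the purely algebraic identity behind it: there is an INTEGER polynomial `R` whose image
in `ℂ[X]` is `C (lead(P_ℂ) ^ deg Q) · ∏_{a ∈ roots P_ℂ} Q_ℂ(X - a)` (complex roots of `P` with
multiplicity; `P_ℂ`, `Q_ℂ` the images of `P`, `Q` in `ℂ[X]`).

## Proof

Work in `ℤ[X][Y] = Polynomial (Polynomial ℤ)`: `f₀ = P(Y)` (`P.map C`) and `g₀ = Q(X - Y)`
(`(Q.map C).comp (C X - Y)`), `R = Polynomial.resultant f₀ g₀ (deg P) (deg Q)`.  Mapping
coefficient-wise to `ℂ[X]` commutes with the resultant (`Polynomial.resultant_map_map`), and over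
the domain `ℂ[X]` the resultant of the split polynomial `P_ℂ(Y) = P_ℂ.map C` (roots `C a`, `a` a
complex root of `P`) against `Q_ℂ(X - Y)` is `lead ^ deg Q · ∏_a Q_ℂ(X - Y)|_{Y = C a}`
(`Polynomial.resultant_eq_prod_eval`), and `Q_ℂ(X - Y)|_{Y = C a} = Q_ℂ.comp (X - C a)`.

## Contents

* `map_map_C_int`, `map_shift_int`, `eval_C_shift`, `natDegree_shift_le` — bookkeeping in `ℂ[X][Y]`;
* `resultant_pairSum_map` — the identity for the explicit resultant;
* `stub_pairSumResultant` — the registered stub, by name.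
-/

noncomputable section

-- `Summit.Schanuel.Schanuel.…` is the mandated summit/sub-problem namespace, hence:
set_option linter.dupNamespace false

namespace Summit.Schanuel.Schanuel.Cruxes.KhovanskiiApproxTypeEv.AnchoredReduction

open Polynomial
open scoped Polynomial.Bivariate

/-- Coefficient-wise complexification of `P(Y) ∈ ℤ[X][Y]` is `P_ℂ(Y) ∈ ℂ[X][Y]`. [folklore] -/
theorem map_map_C_int (P : ℤ[X]) :
    (P.map (C : ℤ →+* ℤ[X])).map (mapRingHom (Int.castRingHom ℂ)) =
      (P.map (Int.castRingHom ℂ)).map (C : ℂ →+* ℂ[X]) := by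
  rw [Polynomial.map_map, Polynomial.map_map, mapRingHom_comp_C]

/-- Coefficient-wise complexification of `Q(X - Y) ∈ ℤ[X][Y]` is `Q_ℂ(X - Y) ∈ ℂ[X][Y]`.
[folklore] -/
theorem map_shift_int (Q : ℤ[X]) :
    ((Q.map (C : ℤ →+* ℤ[X])).comp (C X - Y)).map (mapRingHom (Int.castRingHom ℂ)) =
      ((Q.map (Int.castRingHom ℂ)).map (C : ℂ →+* ℂ[X])).comp (C X - Y) := by
  rw [Polynomial.map_comp, map_map_C_int, Polynomial.map_sub, Polynomial.map_C, Polynomial.map_X,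
    Polynomial.coe_mapRingHom, Polynomial.map_X]

/-- Substituting the constant `Y = a` in `Q_ℂ(X - Y)` gives `Q_ℂ(X - a)`. [folklore] -/
theorem eval_C_shift (Qc : ℂ[X]) (a : ℂ) :
    (((Qc.map (C : ℂ →+* ℂ[X])).comp (C X - Y)).eval (C a)) = Qc.comp (X - C a) := by
  rw [Polynomial.eval_comp, Polynomial.eval_sub, Polynomial.eval_C, Polynomial.eval_X,
    Polynomial.eval_map]
  rfl

/-- `deg_Y Q_ℂ(X - Y) ≤ deg Q`. [folklore] -/
theorem natDegree_shift_le (Q : ℤ[X]) :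
    (((Q.map (Int.castRingHom ℂ)).map (C : ℂ →+* ℂ[X])).comp (C X - Y)).natDegree ≤
      Q.natDegree := by
  refine Polynomial.natDegree_comp_le.trans ?_
  have h1 : (C X - Y : ℂ[X][Y]).natDegree = 1 := by
    rw [← neg_sub, natDegree_neg, natDegree_X_sub_C]
  rw [h1, mul_one]
  exact Polynomial.natDegree_map_le.trans Polynomial.natDegree_map_le

/-- **The resultant identity.** With `f₀ = P(Y)` and `g₀ = Q(X - Y)` in `ℤ[X][Y]`, the integer
polynomial `Res_Y^{(deg P, deg Q)}(f₀, g₀) ∈ ℤ[X]` maps in `ℂ[X]` to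
`C (lead(P_ℂ) ^ deg Q) · ∏_{a ∈ roots P_ℂ} Q_ℂ(X - a)` (roots with multiplicity):
`Polynomial.resultant_map_map` and `Polynomial.resultant_eq_prod_eval` over the domain `ℂ[X]`,
where `P_ℂ(Y)` splits with roots `C a`. [folklore] -/
theorem resultant_pairSum_map (P Q : ℤ[X]) :
    (Polynomial.resultant (P.map (C : ℤ →+* ℤ[X])) ((Q.map (C : ℤ →+* ℤ[X])).comp (C X - Y))
        P.natDegree Q.natDegree).map (Int.castRingHom ℂ) =
      C ((P.map (Int.castRingHom ℂ)).leadingCoeff ^ Q.natDegree) *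
        ((P.map (Int.castRingHom ℂ)).roots.map
          (fun a => (Q.map (Int.castRingHom ℂ)).comp (X - C a))).prod := by
  have hsplit : (P.map (Int.castRingHom ℂ)).Splits := IsAlgClosed.splits _
  have hsplitC : ((P.map (Int.castRingHom ℂ)).map (C : ℂ →+* ℂ[X])).Splits := hsplit.map C
  have hdeg : ((P.map (Int.castRingHom ℂ)).map (C : ℂ →+* ℂ[X])).natDegree = P.natDegree := by
    rw [natDegree_map_eq_of_injective (C_injective), natDegree_map_eq_of_injective
      (Int.castRingHom ℂ).injective_int]
  rw [← Polynomial.coe_mapRingHom, ← Polynomial.resultant_map_map, map_map_C_int, map_shift_int,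
    ← hdeg, Polynomial.resultant_eq_prod_eval _ _ _ (natDegree_shift_le Q) hsplitC,
    leadingCoeff_map_of_injective (C_injective), ← C_pow, hsplit.roots_map C, Multiset.map_map]
  congr 2
  refine Multiset.map_congr rfl fun a _ => ?_
  exact eval_C_shift _ a

/-- **Registered stub `stub_pairSumResultant`.** For non-zero `P, Q ∈ ℤ[X]` there is an integer
polynomial `R` (namely `Res_Y (P(Y), Q(X - Y))`, at formal degrees `(deg P, deg Q)`) whose image in
`ℂ[X]` is `C (lead(P_ℂ) ^ deg Q) · ∏_{P(a) = 0} Q_ℂ(X - a)` (complex roots of `P` with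
multiplicity).  The identity holds for all `P`, `Q`; the non-vanishing hypotheses are part of the
registered interface (they make the product a genuine annihilator of pair sums, see the sibling
stubs). [folklore] -/
theorem stub_pairSumResultant (P Q : Polynomial ℤ) (hP : P ≠ 0) (hQ : Q ≠ 0) :
    ∃ R : Polynomial ℤ, R.map (Int.castRingHom ℂ) =
      Polynomial.C ((P.map (Int.castRingHom ℂ)).leadingCoeff ^ Q.natDegree) *
        ((P.map (Int.castRingHom ℂ)).roots.map
          (fun a => (Q.map (Int.castRingHom ℂ)).comp (Polynomial.X - Polynomial.C a))).prod := by
  -- `hP`, `hQ` belong to the registered interface (the sibling stubs on the same product use them);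
  -- the identity itself is unconditional in `P`, `Q`, so they are consumed vacuously.
  refine (fun _ _ => ?_) hP hQ
  exact ⟨_, resultant_pairSum_map P Q⟩

end Summit.Schanuel.Schanuel.Cruxes.KhovanskiiApproxTypeEv.AnchoredReduction

end
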